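import Literature.AlgebraicGeometry.HodgeTheory.AbelianVarietyEndomorphismsCupPairings
import Literature.AlgebraicGeometry.HodgeTheory.AbelianVarietyMiddleIntersectionLatticeOdd
import HarnessLib

/-!
# Automorphisms of a complex abelian variety act by isometries on the middle lattice `(H^g(A(ℂ); ℤ)/T, Q_μ)`; endomorphisms act
# as similitudes of ratio `deg f`, on the ALGEBRAIC Betti carrier

Layer `Literature/AlgebraicGeometry/HodgeTheory`, namespace `Literature.AlgebraicGeometry.HodgeTheory` (theorems in the `AbelianVariety`
namespace).  THEOREMS ONLY (no definition, no named fact, net debt 0).  Sequel of `AbelianVarietyEndomorphismsCupPairings`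
(`⟨f^*x ⌣ f^*y, [A(ℂ)]_μ⟩ = deg f · ⟨x ⌣ y, [A(ℂ)]_μ⟩`, automorphisms preserve every cup pairing) and of the middle-lattice files
(`AbelianVarietyMiddleIntersectionLatticeEven/Odd`): the pull-back `u^*` of an automorphism `u` is turned into a `ℤ`-linear automorphism of
`Hᵏ(A(ℂ); ℤ)` (inverse `(u⁻¹)^*`, functoriality) and into a lattice isometry of `(H^g(A(ℂ); ℤ)/T, Q_μ)` — the representation
`Aut(A) → O(H^g(A(ℂ); ℤ)/T)` elementwise.

H. Lange, *Abelian Varieties over the Complex Numbers* (2023), §1.1.2 (PDF pp. 19–22): the rational representation `ρ_r : End(X) → End_ℤ(Λ)`,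
Prop. 1.1.15 (isomorphisms), §1.7 proof of Cor. 1.7.6 (PDF p. 73) («`∫_Y f^*η = deg f · ∫_X η`»); A. Hatcher, *Algebraic Topology* (2002),
§3.1 (functoriality `(fg)^* = g^* f^*`, `𝟙^* = 𝟙`), §3.2 Prop. 3.10 (`f^*(α ⌣ β) = f^*α ⌣ f^*β`), §3.3 p. 250 (the lattice `Hⁿ_free(M)`).

## What is proved

For `A : AbelianVariety ℂ`, homomorphisms `f, g : A ⟶ A` (`f(ℂ) = AlgPoints.mapContinuous f.hom.hom.hom`):

* §1 `singularCohomology_map_comp_hom` (`(f ≫ g)(ℂ)^* = f(ℂ)^* ∘ g(ℂ)^*` on `Hᵏ(A(ℂ); ℤ)`), `singularCohomology_map_id_hom`;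
  **`exists_linearEquiv_eq_map_of_isIso`** — for an automorphism `u`, `u(ℂ)^*` is a `ℤ`-linear automorphism of `Hᵏ(A(ℂ); ℤ)` (inverse `(u⁻¹)(ℂ)^*`);
* §2 **`exists_isometryEquiv_intersectionForm_of_isIso`** — for every orientation `μ`, an automorphism `u` induces a lattice ISOMETRY `φ` of
  `(H^g(A(ℂ); ℤ)/T, Q_μ)` with `φ [x] = [u^* x]`;
* §3 `intersectionForm_mk_map_mk_map` — for an endomorphism `f`, `Q_μ([f^*x], [f^*y]) = deg f · Q_μ([x], [y])`;
  `mk_map_injective_of_natCard_kerPoints_ne_zero` — for an isogeny, `[x] ↦ [f^*x]` is injective on `H^g(A(ℂ); ℤ)/T`.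

## References

* [Lange2023AbelianVarietiesComplex] H. Lange, *Abelian Varieties over the Complex Numbers*, Springer 2023 — §1.1.2 (PDF pp. 19–22), Prop. 1.1.15;
  §1.7 proof of Cor. 1.7.6 (PDF p. 73).
* [HatcherAT2002] A. Hatcher, *Algebraic Topology*, CUP 2002 — §3.1, §3.2 Prop. 3.10, §3.3 p. 250.

## Provenance
Lane `lit-hodgefound` (Hodge path, Track 2), prover seat `lit-hodgefound-p21` (generation 43), self-proposed row g43-#10 (CLAIM BY PATH).
-/

noncomputable section

open CategoryTheory Module Function
open Literature.AlgebraicTopology.SingularHomology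

namespace Literature.AlgebraicGeometry.HodgeTheory

open Literature.AlgebraicGeometry.Motives (ComplexPoints IsSmoothProjective AbelianVariety SchemeOver AlgPoints specOver)
open Literature.AlgebraicGeometry.Motives.AbelianVariety (Hom.kerPoints)

namespace AbelianVariety

variable (A : AbelianVariety ℂ)

/-! ### §1 Functoriality on `Hᵏ(A(ℂ); ℤ)`; `u^*` as a `ℤ`-linear automorphism -/

/-- **`(f ≫ g)(ℂ)^* = f(ℂ)^* ∘ g(ℂ)^*` on `Hᵏ(A(ℂ); ℤ)`** (contravariant functoriality of integral cohomology along homomorphisms).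
[cite: HatcherAT2002, §3.1 (induced homomorphisms)] -/
theorem singularCohomology_map_comp_hom {B C : AbelianVariety ℂ} (f : A ⟶ B) (g : B ⟶ C) (k : ℕ) :
    singularCohomology.map ℤ ℤ (AlgPoints.mapContinuous (L := ℂ) (f ≫ g).hom.hom.hom) k =
      singularCohomology.map ℤ ℤ (AlgPoints.mapContinuous (L := ℂ) g.hom.hom.hom) k ≫
        singularCohomology.map ℤ ℤ (AlgPoints.mapContinuous (L := ℂ) f.hom.hom.hom) k := by
  change singularCohomology.map ℤ ℤ (AlgPoints.mapContinuous (L := ℂ) (f.hom.hom.hom ≫ g.hom.hom.hom)) k = _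
  rw [AlgPoints.mapContinuous_comp, singularCohomology.map_comp]

/-- **`(𝟙 A)(ℂ)^* = 𝟙` on `Hᵏ(A(ℂ); ℤ)`.** [cite: HatcherAT2002, §3.1 (induced homomorphisms)] -/
theorem singularCohomology_map_id_hom (k : ℕ) :
    singularCohomology.map ℤ ℤ (AlgPoints.mapContinuous (L := ℂ) (𝟙 A : A ⟶ A).hom.hom.hom) k = 𝟙 _ := by
  change singularCohomology.map ℤ ℤ (AlgPoints.mapContinuous (L := ℂ) (𝟙 A.X)) k = _
  rw [AlgPoints.mapContinuous_id, singularCohomology.map_id]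

/-- **For an automorphism `u` of `A`, `u(ℂ)^*` is a `ℤ`-linear AUTOMORPHISM of `Hᵏ(A(ℂ); ℤ)`**, with inverse `(u⁻¹)(ℂ)^*`
(`u^* (u⁻¹)^* = (u⁻¹ u)^* = 𝟙`). [cite: Lange2023AbelianVarietiesComplex, §1.1.2 (PDF pp. 19–22) and Prop. 1.1.15] [cite: HatcherAT2002, §3.1] -/
theorem exists_linearEquiv_eq_map_of_isIso (u : A ⟶ A) [IsIso u] (k : ℕ) :
    ∃ ψ : singularCohomology ℤ ℤ (ComplexPoints A.X) k ≃ₗ[ℤ] singularCohomology ℤ ℤ (ComplexPoints A.X) k,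
      ∀ x, ψ x = singularCohomology.map ℤ ℤ (AlgPoints.mapContinuous (L := ℂ) u.hom.hom.hom) k x := by
  refine ⟨LinearEquiv.ofLinear (singularCohomology.map ℤ ℤ (AlgPoints.mapContinuous (L := ℂ) u.hom.hom.hom) k).hom
    (singularCohomology.map ℤ ℤ (AlgPoints.mapContinuous (L := ℂ) (inv u).hom.hom.hom) k).hom ?_ ?_, fun x ↦ rfl⟩
  · rw [← ModuleCat.hom_comp, ← singularCohomology_map_comp_hom, IsIso.hom_inv_id, singularCohomology_map_id_hom, ModuleCat.hom_id]
  · rw [← ModuleCat.hom_comp, ← singularCohomology_map_comp_hom, IsIso.inv_hom_id, singularCohomology_map_id_hom, ModuleCat.hom_id]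

/-! ### §2 Automorphisms act by isometries on the middle lattice -/

/-- **`Aut(A) → O(H^g(A(ℂ); ℤ)/T, Q_μ)`: an automorphism `u` of a complex abelian variety induces a lattice ISOMETRY of the middle intersection
lattice, `φ [x] = [u(ℂ)^* x]`**, for every orientation `μ` (`⟨u^*x ⌣ u^*y, [A(ℂ)]_μ⟩ = ⟨x ⌣ y, [A(ℂ)]_μ⟩`, `u^*` invertible, and
`H^g(A(ℂ); ℤ) → H^g(A(ℂ); ℤ)/T` bijective). [cite: Lange2023AbelianVarietiesComplex, §1.7 proof of Cor. 1.7.6 (PDF p. 73) and §1.1.2 Prop. 1.1.15]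
[cite: HatcherAT2002, §3.2 Prop. 3.10 and §3.3 p. 250] -/
theorem exists_isometryEquiv_intersectionForm_of_isIso (u : A ⟶ A) [IsIso u]
    (μ : HomologicalOrientation ℤ (ComplexPoints A.X) (2 * A.dim)) (hdeg : A.dim + A.dim = 2 * A.dim) :
    ∃ φ : (intersectionForm hdeg μ).IsometryEquiv (intersectionForm hdeg μ),
      ∀ x, φ (freeCohomology.mk x) =
        freeCohomology.mk (singularCohomology.map ℤ ℤ (AlgPoints.mapContinuous (L := ℂ) u.hom.hom.hom) A.dim x) := by
  obtain ⟨ψ, hψ⟩ := exists_linearEquiv_eq_map_of_isIso A u A.dim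
  let π : singularCohomology ℤ ℤ (ComplexPoints A.X) A.dim ≃ₗ[ℤ] freeCohomology ℤ (ComplexPoints A.X) A.dim :=
    LinearEquiv.ofBijective freeCohomology.mk (bijective_freeCohomology_mk A A.dim)
  have hπ : ∀ a, π a = freeCohomology.mk a := fun a ↦ rfl
  have hπ' : ∀ a, π.symm (freeCohomology.mk a) = a := fun a ↦ by rw [← hπ a, LinearEquiv.symm_apply_apply]
  refine ⟨{ (π.symm.trans ψ).trans π with
    map_app' := fun a b ↦ ?_ }, fun x ↦ ?_⟩
  · obtain ⟨x, rfl⟩ := freeCohomology.mk_surjective a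
    obtain ⟨y, rfl⟩ := freeCohomology.mk_surjective b
    change intersectionForm hdeg μ (π (ψ (π.symm (freeCohomology.mk x)))) (π (ψ (π.symm (freeCohomology.mk y)))) =
      intersectionForm hdeg μ (freeCohomology.mk x) (freeCohomology.mk y)
    rw [hπ', hπ', hπ, hπ, intersectionForm_mk_mk, intersectionForm_mk_mk, hψ, hψ, cupPairing_map_map_of_isIso]
  · change π (ψ (π.symm (freeCohomology.mk x))) = _
    rw [hπ', hπ, hψ]

/-! ### §3 Endomorphisms act as similitudes of ratio `deg f` on the middle lattice -/

/-- **`Q_μ([f^*x], [f^*y]) = deg f · Q_μ([x], [y])` on `H^g(A(ℂ); ℤ)/T`** for every endomorphism `f` and every orientation `μ`.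
[cite: Lange2023AbelianVarietiesComplex, §1.7 proof of Cor. 1.7.6 (PDF p. 73)] [cite: HatcherAT2002, §3.3 p. 250] -/
theorem intersectionForm_mk_map_mk_map (f : A ⟶ A) (μ : HomologicalOrientation ℤ (ComplexPoints A.X) (2 * A.dim))
    (hdeg : A.dim + A.dim = 2 * A.dim) (x y : singularCohomology ℤ ℤ (ComplexPoints A.X) A.dim) :
    intersectionForm hdeg μ (freeCohomology.mk (singularCohomology.map ℤ ℤ (AlgPoints.mapContinuous (L := ℂ) f.hom.hom.hom) A.dim x))
        (freeCohomology.mk (singularCohomology.map ℤ ℤ (AlgPoints.mapContinuous (L := ℂ) f.hom.hom.hom) A.dim y)) =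
      (Nat.card (Hom.kerPoints (specOver ℂ ℂ) f) : ℤ) * intersectionForm hdeg μ (freeCohomology.mk x) (freeCohomology.mk y) := by
  rw [intersectionForm_mk_mk, intersectionForm_mk_mk, cupPairing_map_map]

/-- **For an isogeny (`deg f ≠ 0`), `[x] ↦ [f^*x]` is injective on the middle lattice `H^g(A(ℂ); ℤ)/T`** (`f^*` is injective on `H^g(A(ℂ); ℤ)`
and `H^g(A(ℂ); ℤ) → H^g(A(ℂ); ℤ)/T` is bijective). [cite: Lange2023AbelianVarietiesComplex, §1.7 proof of Cor. 1.7.6 (PDF p. 73) and §1.1.2 (PDF pp. 20–22)] -/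
theorem mk_map_injective_of_natCard_kerPoints_ne_zero (f : A ⟶ A) (hf : Nat.card (Hom.kerPoints (specOver ℂ ℂ) f) ≠ 0) (k : ℕ) :
    Injective fun x : singularCohomology ℤ ℤ (ComplexPoints A.X) k ↦
      freeCohomology.mk (singularCohomology.map ℤ ℤ (AlgPoints.mapContinuous (L := ℂ) f.hom.hom.hom) k x) :=
  (bijective_freeCohomology_mk A k).1.comp (singularCohomology_map_injective_of_natCard_kerPoints_ne_zero A f hf k)

end AbelianVariety

end Literature.AlgebraicGeometry.HodgeTheory

end
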